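import Summits.ResolutionOfSingularities.ResolutionOfSingularities.Theorems.FrobeniusClosingPatchingRelPerfectDepthTargetsWeightedDefs
import Literature.AlgebraicGeometry.Resolution.RegularCentreRsopGenerated
import HarnessLib

/-!
# Crux `PatchingRelPerfect` (stmt-ResolutionOfSingularities-16161), chain W5.2 — rung R4, E-side target
# `OrderPermissible` of the typed targets «F2» CLOSED BY NAME

[OURS · L1 W5.2 · TargetsF2 (c)] `DepthTargets.OrderPermissible` (res-L1-w52-plan-1 gen 6,
`ChainW52TargetsF2.lean` sha16 `79dee2c27fd85ddd`, in the tree as `…Theorems.FrobeniusClosingPatchingRelPerfectDepthTargetsWeightedDefs`):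
on a Noetherian regular scheme `E`, a centre `C` with `V(C)` regular lying inside the order locus
`{x | ν ≤ ord_x 𝔟}` satisfies `𝔟 ≤ C ^ ν` — the bridge from the literature's SUPPORT condition on centres
(BGMW Def. 3.1.3 (1), Kollár 3.30.2) to the ideal-theoretic permissibility hypothesis `K ≤ Ĉ^ν` of the weighted
dictionary steps (D1 / D_ℓ `DictionaryStepPow`, `IsWeightedSeq`). The CONTENT is the Literature theorem
`le_pow_of_isRegular_subscheme_of_forall_le_idealOrder_of_isRegular` (`Resolution/RegularCentreRsopGenerated.lean`,
p501951: Matsumura 14.2 — a regular centre on a regular scheme is generated at each of its points by part of a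
regular system of parameters — feeding the tree's BGMW Lemma 3.2.1 (1) `le_pow_of_support_subset`, whose proof goes
through the generic points of `V(C)` and the equality of ordinary and symbolic powers for such primes,
`SymbolicPowersRsop.lean`). This file is the three-line by-name closer. Fact-free; NOT a statement of the
manuscript under review.

## References
* E. Bierstone, D. Grigoriev, P. Milman, J. Włodarczyk, arXiv:1206.3090, §3.1 Def. 3.1.3 (1), §3.2 Lemma 3.2.1 (1).
  [BierstoneGrigorievMilmanWlodarczyk2011]
* H. Matsumura, *Commutative Ring Theory* (1986), Thm. 14.2, Thm. 16.2 (ii). [Matsumura1987]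
* J. Kollár, *Lectures on Resolution of Singularities* (2007), 3.30.2. [Kollar2007]
-/

-- `Summit.<Summit>.<Sub>.Theorems` with `Sub = Summit` (single-conjunct summit, D-0017)
set_option linter.dupNamespace false

noncomputable section

open CategoryTheory CategoryTheory.Limits AlgebraicGeometry TopologicalSpace
open Literature.AlgebraicGeometry.Resolution

namespace Summit.ResolutionOfSingularities.ResolutionOfSingularities.Theorems.DepthTargets

universe u

/-- [OURS · L1 W5.2 · TargetsF2 (c)] **`OrderPermissible` holds**: on a Noetherian regular scheme, a centre with
regular `V(C)` inside the order-`ν` locus of `𝔟` satisfies `𝔟 ≤ C ^ ν` (BGMW Lemma 3.2.1 (1) for regular centres,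
`le_pow_of_isRegular_subscheme_of_forall_le_idealOrder_of_isRegular`).
[cite: BierstoneGrigorievMilmanWlodarczyk2011, Lemma 3.2.1 (1)] [cite: Matsumura1987, Thm. 14.2] -/
theorem orderPermissible_holds : OrderPermissible.{u} := by
  intro E _ hE C 𝔟 ν hC hord
  exact le_pow_of_isRegular_subscheme_of_forall_le_idealOrder_of_isRegular hE hC hord

end Summit.ResolutionOfSingularities.ResolutionOfSingularities.Theorems.DepthTargets

end
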